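import Summits.ResolutionOfSingularities.ResolutionOfSingularities.Theorems.ChainW52TargetsF7Beta
import Summits.ResolutionOfSingularities.ResolutionOfSingularities.Theorems.FrobeniusClosingPatchingRelPerfectTowerContraction
import Summits.ResolutionOfSingularities.ResolutionOfSingularities.Theorems.ValuativePatchingRelBlowupSequenceComposite
import Literature.AlgebraicGeometry.Resolution.ExcellentBlowup
import HarnessLib

/-!
# Crux `PatchingRelPerfect` (stmt-ResolutionOfSingularities-16161), chain W5.2 — F7(β) (β-AX) d = 2, T5: THE COMPOSITION
# `betaTwo_atomConclusion_of_targets : ChainW52F7Beta.BetaTwoComposition₂`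

[OURS · L1 W5.2 · F7(β) (β-AX) · T5 · res-L1-w52-plan-1 RULING G11-29 (3)(b), hand res-D-repro-1 AS res-L1-repro-3] The (β) d = 2 atom
conclusion `BetaTwoAtomConclusion₂` from the four typed targets of `ChainW52TargetsF7Beta` (p552304): T0 `InitialMultiHost₂`, T2
`CJSTransport₂`, T2c `FormatEndOnCyl₂` and ONE pole atlas `P` with `StepStable P`, `AtlasInitial P`, `PhaseCTermination₂ P` (T3) —
i.e. a PROOF of the composition statement `BetaTwoComposition₂`, fact-free (F-32bR enters only through the `CJSTransport₂` hypothesis,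
supplied downstream as `transport_of_cjsB hlift hCJS`).  NOT a statement of the manuscript under review; AI-written, weaker than expert
review.  Mathlib + landed W5.2 files only; no definition, no fact, no sorry.

## The proof (pattern `atomConclusion_of_tower`, `…TowerContraction` l.114)
Zero forms are discarded (`exists_gradedMemberIdeal_eq_of_ne_zero`: the graded member ideal of a family is that of its non-zero
sub-family).  T0 gives the initial cylinder state `(St, cyl)` on `X` over `Spec S` with the depth-two invariant (`I𝒪_X = M₀ · K`, `M₀`
effective Cartier, `St.K = K`, `g : X → Spec S` a blowing up cosupported in the closed point, `E`-points over the closed point) and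
`cyl.V = ⊤`, so the atlas holds at generation 0 (`AtlasInitial`).  T2 transports one CJS run: `π : X₁ → X` a blowing up cosupported in
the carrier (hence over the closed point), `S₁.K = K𝒪_{X₁}`, `S₁.n = St.n ≠ 0`, `X₁` regular (and excellent, `IsBlowup.isExcellent`), the
atlas kept, one snc family presenting the traces.  T2c puts `S₁` in format-snc END on `cyl₁.V`.  T3 (Phase C) yields regular centres `s`
over `cosupp S₁.K` with regular Noetherian top and the RESIDUAL FACTORISATION `S₁.K𝒪_{top} = M · S♭.K`, `M` effective Cartier, `S♭`
format-snc on `U′ ⊇ cosupp S♭.K` with `S♭.n ≠ 0`; E1 + T4 (`IsFormatSncOn.exists_centreSeq`, p546954/p543632) principalise `S♭.K` by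
regular centres `s₂` over `cosupp S♭.K` with regular top.  All centres lie over the closed point (`cosupp K ⊆ V(𝓘_E²) = E`,
`cosupp S♭.K ⊆ cosupp (M · S♭.K)`), so `g`, `π`, `s`, `s₂` compose to ONE blowing up of `Spec S` cosupported in the closed point
(`IsBlowup.exists_isBlowup_comp_supported`, `CentreSeq.exists_isBlowup_comp_of_centresOver` — Temkin 2.1.4 / Stacks 080B), on whose
regular top `I𝒪 = M₀𝒪 · M𝒪 · S♭.K𝒪` is locally principal (`IsLocallyPrincipal.comap/.mul`); `atomConclusion_of_tower` contracts the
tower to the registered conclusion for every `T = Bl_I Spec S`.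

## References
* J. Kollár, *Lectures on Resolution of Singularities* (2007), (3.111) Step 3. [Kollar2007]
* M. Temkin, *Desingularization of quasi-excellent schemes in characteristic zero*, Adv. Math. 219 (2008), Lemma 2.1.4. [Temkin2008]
* The Stacks Project, Tags 080A, 080B. [StacksProject]
-/

-- `Summit.<Summit>.<Sub>.Theorems` with `Sub = Summit` (single-conjunct summit, D-0017)
set_option linter.dupNamespace false

noncomputable section

open CategoryTheory CategoryTheory.Limits AlgebraicGeometry TopologicalSpace IsLocalRing
open Literature.AlgebraicGeometry.Resolution Scheme.IdealSheafData
open Literature.AlgebraicGeometry.Hironaka2017.MonomialPart Literature.AlgebraicGeometry.Motives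

namespace Summit.ResolutionOfSingularities.ResolutionOfSingularities.Theorems

universe u

namespace ChainW52F7Beta

open DepthMultiHost

section T5

open DepthTargets

/-- **Zero forms do not matter**: the graded member ideal of a family of polynomials is that of its sub-family of non-zero
members (a zero polynomial evaluates to `0`). [folklore] -/
theorem exists_gradedMemberIdeal_eq_of_ne_zero {κ₀ S : Type u} [CommRing κ₀] [CommRing S] (σ : κ₀ →+* S) {n s : ℕ}
    (x : Fin n → S) (d ℓ : ℕ) (P : Fin s → MvPolynomial (Fin n) κ₀) :
    ∃ (s' : ℕ) (e : Fin s' → Fin s), (∀ k, P (e k) ≠ 0) ∧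
      gradedMemberIdeal σ x d ℓ (P ∘ e) = gradedMemberIdeal σ x d ℓ P := by
  classical
  let φ := Fintype.equivFin {j : Fin s // P j ≠ 0}
  refine ⟨Fintype.card {j : Fin s // P j ≠ 0}, fun k => (φ.symm k).1, fun k => (φ.symm k).2, ?_⟩
  unfold gradedMemberIdeal
  congr 1
  apply le_antisymm
  · refine Ideal.span_le.mpr ?_
    rintro _ ⟨k, rfl⟩
    exact Ideal.subset_span ⟨(φ.symm k).1, rfl⟩
  · refine Ideal.span_le.mpr ?_
    rintro _ ⟨j, rfl⟩
    by_cases hj : P j = 0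
    · change MvPolynomial.eval₂Hom σ x (P j) ∈ _
      rw [hj, map_zero]
      exact Ideal.zero_mem _
    · exact Ideal.subset_span ⟨φ ⟨j, hj⟩, by simp [φ]⟩

/-- [OURS · L1 W5.2 · F7(β) (β-AX) T5] **THE COMPOSITION `betaTwo_atomConclusion_of_targets : BetaTwoComposition₂`** (res-L1-w52-plan-1
RULING G11-29 (3)(b); pattern `atomConclusion_of_tower`): T0 gives the initial cylinder state on `X = Bl_𝔪 Spec S` with the depth-two
invariant `I𝒪_X = M₀ · K`; the pole atlas `P` holds there (`AtlasInitial`, `cyl.V = ⊤`); T2 transports one CJS run (`π : X₁ → X`, a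
blowing up cosupported in the carrier, `S₁.K = K𝒪_{X₁}`, `P` kept); T2c puts `S₁` in format-snc END on the cylinder open; T3 (Phase C)
gives regular centres over `cosupp S₁.K` with regular top and the RESIDUAL FACTORISATION `S₁.K𝒪 = M · S♭.K`, `M` effective Cartier, `S♭`
format-snc on `U′ ⊇ cosupp S♭.K`; E1 + T4 (`IsFormatSncOn.exists_centreSeq`) principalise `S♭.K` by regular centres over its cosupport
with regular top; all four towers have centres over the closed point, so they compose to ONE blowing up of `Spec S` cosupported in the
closed point (`IsBlowup.exists_isBlowup_comp_supported`, `CentreSeq.exists_isBlowup_comp_of_centresOver`) on whose regular top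
`I𝒪 = M₀𝒪 · M𝒪 · S♭.K𝒪` is locally principal; `atomConclusion_of_tower` contracts.  Zero forms are discarded first
(`exists_gradedMemberIdeal_eq_of_ne_zero`).  Fact-free as a composition: F-32bR enters only through the `CJSTransport₂` hypothesis.
[cite: Kollar2007, (3.111) Step 3] [cite: StacksProject, Tag 080A] [cite: Temkin2008, Lemma 2.1.4] -/
theorem betaTwo_atomConclusion_of_targets : BetaTwoComposition₂.{u} := by
  rintro hT0 hT2 hT2c ⟨Pa, hPa, hPa₀, hC⟩ S _ _ _ hdim κ₀ _ σ hσ x hx s Pf hPf hI T f hf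
  classical
  -- discard the zero forms
  obtain ⟨s', e, hne, hIe⟩ := exists_gradedMemberIdeal_eq_of_ne_zero σ x 2 2 Pf
  rw [← hIe] at hI hf
  -- T0: the initial cylinder state
  obtain ⟨X, g, i, K, instX, St, cyl, instZ₁, instZ₂, hinv, hXexc, hStK, hn0, h𝓔, hrange, hV, hZreg, hZexc, hZdim⟩ :=
    hT0 S hdim κ₀ σ hσ x hx s' (Pf ∘ e) (fun k => hPf (e k)) hne
  haveI := hinv.isClosedImmersion
  -- T2: one CJS run, transported (the atlas holds at generation 0 by `AtlasInitial`)
  obtain ⟨X₁, π, instX₁, S₁, cyl₁, ρ, instZ₃, instZ₄, 𝓔₁, hPS₁, ⟨Q, hπQ, hQsupp⟩, hX₁reg, hK₁, hn₁, -, hZ₁reg, hsnc₁, hnodup₁, -,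
    hirr₁, hbd₁, htr₁⟩ := hT2 Pa hPa hinv.isRegular St cyl hZreg hZexc hZdim h𝓔 (hPa₀ St cyl hV)
  -- T2c: format-snc END on the cylinder open
  obtain ⟨𝓒, 𝓗, hfmt⟩ := hT2c hX₁reg S₁ cyl₁ hZ₁reg 𝓔₁ hsnc₁ hnodup₁ hirr₁ hbd₁ htr₁
  -- T3: Phase C in the residual currency
  obtain ⟨sq, -, hsover, hstop, instTop, M, Sf, hfac, hM, hSfn, U', 𝓒', 𝓗', hfmt', hU'⟩ :=
    hC hX₁reg (hπQ.isExcellent hXexc) S₁ cyl₁ hZ₁reg (hn₁ ▸ hn0 :) 𝓒 𝓗 hfmt hPS₁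
  -- E1 + T4 on the residual state
  obtain ⟨s₂, -, hs₂over, htop₂, hlp₂⟩ := hfmt'.exists_centreSeq hstop hSfn hU'
  -- the format on `X` and the blow-up data of `g`
  obtain ⟨M₀, hM₀, hIMK⟩ := hinv.exists_format
  obtain ⟨K₀, hgK₀, hK₀⟩ := hinv.exists_isBlowup_supported
  -- every centre lies over the closed point
  have hKsupp : (K.support : Set X) ⊆ g ⁻¹' {IsLocalRing.closedPoint S} := by
    intro y hy
    have hy' : y ∈ (i.ker.support : Set X) := by
      have h2 : K.support ≤ (i.ker ^ 2).support := support_antitone hinv.ker_pow_le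
      rw [support_pow i.ker 2 two_ne_zero] at h2
      exact h2 hy
    rw [Scheme.Hom.support_ker, i.isClosedEmbedding.isClosed_range.closure_eq] at hy'
    obtain ⟨e', rfl⟩ := hy'
    exact hinv.map_eq_closedPoint e'
  have hQsupp' : (Q.support : Set X) ⊆ g ⁻¹' {IsLocalRing.closedPoint S} := by
    intro y hy
    obtain ⟨z, rfl⟩ := hrange (hQsupp hy)
    exact hinv.map_eq_closedPoint z
  haveI : IsNoetherianRing (CommRingCat.of S) := inferInstanceAs (IsNoetherianRing S)
  obtain ⟨K₁, hK₁b, hK₁s⟩ := IsBlowup.exists_isBlowup_comp_supported g K₀ π Q _ hgK₀ hK₀ hπQ hQsupp'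
  have hS₁supp : (S₁.K.support : Set X₁) ⊆ (π ≫ g) ⁻¹' {IsLocalRing.closedPoint S} := by
    intro y hy
    rw [hK₁, hStK, support_comap] at hy
    exact hKsupp hy
  obtain ⟨Q₂, hQ₂b, hQ₂s⟩ :=
    CentreSeq.exists_isBlowup_comp_of_centresOver sq _ (CentreSeq.CentresOver.mono sq hS₁supp hsover)
  obtain ⟨K₂, hK₂b, hK₂s⟩ := IsBlowup.exists_isBlowup_comp_supported (π ≫ g) K₁ sq.comp Q₂ _ hK₁b hK₁s hQ₂b hQ₂s
  have hSfsupp : (Sf.K.support : Set sq.top) ⊆ (sq.comp ≫ π ≫ g) ⁻¹' {IsLocalRing.closedPoint S} := by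
    intro y hy
    have h1 : y ∈ ((S₁.K.comap sq.comp).support : Set sq.top) := by
      rw [hfac, support_mul, TopologicalSpace.Closeds.coe_sup]
      exact Or.inr hy
    rw [support_comap] at h1
    exact hS₁supp h1
  obtain ⟨Q₃, hQ₃b, hQ₃s⟩ :=
    CentreSeq.exists_isBlowup_comp_of_centresOver s₂ _ (CentreSeq.CentresOver.mono s₂ hSfsupp hs₂over)
  obtain ⟨K₃, hK₃b, hK₃s⟩ :=
    IsBlowup.exists_isBlowup_comp_supported (sq.comp ≫ π ≫ g) K₂ s₂.comp Q₃ _ hK₂b hK₂s hQ₃b hQ₃s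
  -- `I𝒪 = M₀𝒪 · M𝒪 · S♭.K𝒪` on the top is locally principal
  have hlp : IsLocallyPrincipal
      ((affineBlowup.idealSheaf (gradedMemberIdeal σ x 2 2 (Pf ∘ e))).comap (s₂.comp ≫ sq.comp ≫ π ≫ g)) := by
    rw [comap_comp, comap_comp, comap_comp, hIMK, comap_mul, ← hStK, ← hK₁, comap_mul, hfac, comap_mul, comap_mul]
    exact (((hM₀.isLocallyPrincipal.comap π).comap sq.comp).comap s₂.comp).mul
      ((hM.isLocallyPrincipal.comap s₂.comp).mul hlp₂)
  exact atomConclusion_of_tower hI hK₃b hK₃s htop₂ hlp T f hf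

end T5

end ChainW52F7Beta

end Summit.ResolutionOfSingularities.ResolutionOfSingularities.Theorems

end
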